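import Summits.ResolutionOfSingularities.ResolutionOfSingularities.Theses.EscapeRate
import Summits.ResolutionOfSingularities.ResolutionOfSingularities.Theses.Descent
import Summits.ResolutionOfSingularities.ResolutionOfSingularities.Theorems.WeightedInvariantDescentPerfectToAllPicoverLink
import Summits.ResolutionOfSingularities.ResolutionOfSingularities.Theorems.PAlterationPicoverGiraudSepReduction

/-!
# Crux `DescentPerfectToAll` (stmt-ResolutionOfSingularities-0549) — line `via-giraud-sep`
# (strategist s1, 2026-08-17; ALTERNATIVE line, registered beside the live `via_picover_jung`)

Bet route: `route-ResolutionOfSingularities-EscapeRate` (crux #7, rank 7); the crux is shared verbatim by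
23 routes.  This skeleton concludes the **EscapeRate** copy BY NAME (`DescentPerfectToAll_of`), and also
the `WeightedInvariant` copy (target of the landed edge p113743) and the `Descent` copy (the item's
original decl) — all copies have the same body.

## The line
`DescentPerfectToAll ⟸ Picover ⟸ (Giraud normal form of a height-one class on a separated regular base)
∧ (Kato 1994 (10.4))`, i.e. the composition of three LANDED, sorry-free edges of the tree:

* `Theorems.descentPerfectToAll_of_picover : PAlteration.Picover → WeightedInvariant.DescentPerfectToAll`
  (p113743: robust separable model + iterated one-root reduction + Picover as the radicial bottom);
* `Theorems.Picover.GiraudSepReduction.picover_of_giraudNormalFormSep_of_kato :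
  GNF → Kato1994_logRegular_hasResolution_general → PAlteration.Picover` (landed 2026-08-17: lead a3's
  PROVED local log-regular charts `localChartSep_woundCentre` / `localChartSep_kummerCentre`, the atlas
  `endgameAtlasSep`, transport down `W'^L → W^L`, and `OfDegP.picover_of_picoverDegP` p91343);
* definitional agreement of the route copies of the crux.

So the crux is reduced to exactly TWO registered stubs:

* `stub_giraudNormalFormSep` — RESEARCH content: Giraud's normal-form conjecture for the class of a
  purely inseparable degree-`p` extension `L/K(W)` on a separated regular base `W` (uniform-sections
  format).  VERBATIM the statement of item stmt-ResolutionOfSingularities-18001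
  (`WildQuotients.GiraudNormalFormSep`) = the registered stub `stub_giraudNormalFormSep` of the 0554 line
  `Cruxes/Picover/Lines/giraud_separated_base.lean` — DEDUP THERE (one research item serves 0554, 0557's
  `stub_cossartNormalForm`, RadicialJung.CleanModels 15917 in rider form, and now 0549).  Printed for
  `dim W = 2` (Giraud 1983, Thm. 2.4; perfect `k`) and `dim W = 3` (Cossart 1987; `k = k̄`), restated in
  Posva, arXiv:2311.16694 p. 2 (`u = v^p + x^a`); OPEN for `dim W ≥ 4`
  (`Literature.Barriers.ResolutionOfSingularities.DimensionFourFrontier`).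
* `stub_kato1994LogRegularGeneral` — the NAMED FACT Kato 1994 (10.4) / Nizioł 2006 Thm. 5.8 (a scheme
  with a log-regular Zariski fs atlas has a resolution): printed theorem, literature debt shared with
  0554 (`stub_logResolution`), 0557 and `RadicialJung.CleanResolves`.

## Why this is not the live line again
`via_picover_jung` reaches `Picover` through the RadicialJung endgame
(`CleanModelsSuffice.hasResolution_normalizationIn_of_adaptedModel`, p135821): its research stub is the
ADAPTED-MODEL statement `stub_cleanModelsR` (15917 rider: p-independent monomial / unit-transversal
radicand at every point of a regular model, with chart-compatibility data) and it needs TWO Kato facts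
(`Kato1994_logRegularScheme_hasResolution`, `Kato1994_logRegularLocal_isIntegrallyClosed`).  This line
goes through the Giraud–Cossart normal form `GiraudNormalFormAt` (wound-transversal OR Kummer at every
point, along an snc boundary) — the format in which the `n = 2, 3` theorems are PRINTED and in which the
0554 lead's charts are PROVED — and needs ONE Kato fact (normality of the charts is proved in tree:
`sections_normalizationIn_of_root`, p150000).  Whichever of 18001 / 15917 closes first closes 0549 through
the corresponding skeleton; registering both keeps the 0549 register honest about where the research
content sits after the 0554 cone change of 2026-08-17.

## Why it dodges the stuck goals of the dead 0549 lines
Every 0549-internal line died on a stub kernel-equivalent to the crux (`stub_oneRootStepCoreNormal` ≡ F″ ≡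
crux, skelvet; `stub_robustLevelInseparable` ≡ crux by the flat-colimit lemma, c7).  Here the open stub is
a statement about ONE function class on a REGULAR base — strictly below the summit in type (a
counterexample to it refutes a normal-form conjecture, not resolution), field-blind (no perfectness used or
needed), and it honours `Disproof.crux_of_models` / `not_resolutionBaseChanges`: nothing is base-changed
along an inseparable extension; the imperfect field enters only through `descentPerfectToAll_of_picover`'s
robust separable model (proved).
-/

noncomputable section

set_option linter.dupNamespace false

open CategoryTheory AlgebraicGeometry TopologicalSpace
open Literature.AlgebraicGeometry.Resolution Literature.AlgebraicGeometry.Motives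
open Summit.ResolutionOfSingularities.ResolutionOfSingularities.Theorems

namespace Summit.ResolutionOfSingularities.ResolutionOfSingularities.Cruxes.DescentPerfectToAll.ViaGiraudSep

/-- STUB (research content; ≥ XL; = item stmt-ResolutionOfSingularities-18001 verbatim, = 0554 line
`giraud_separated_base` stub `stub_giraudNormalFormSep` — DEDUP THERE).  **Giraud normal form of a
height-one class on a separated regular base.**  For `W` regular integral separated of finite type over a
field `k` of characteristic `p` and `L/K(W)` purely inseparable of degree `p`: some proper birational
`ρ : W' → W` with `W'` integral regular and an snc boundary `E` such that every point of `W'` has an affine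
neighbourhood `U` carrying a section `a` that represents the class of `L` (some `y ∈ L ∖ K(W)` with
`y^p = c`, `ρ^♯ c = germ a`) and whose germ at EVERY point of `U` is in `GiraudNormalFormAt p x` for a
regular system of parameters `x` adapted to the boundary components through the point (wound-transversal
`a - b^p ∉ 𝔪² + (boundary)` or Kummer `a = unit · ∏ xⱼ^(aⱼ)`, some `aⱼ` prime to `p`).  Printed `dim 2`
(Giraud 1983 Thm. 2.4), `dim 3` (Cossart 1987); open `dim ≥ 4`.  Why plausibly true: it is the
principalization-type half of embedded resolution for the hypersurface `T^p - a`, and every known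
resolution algorithm in char `p` (CJS dim 2, CP dim 3) produces it. [conjecture] -/
theorem stub_giraudNormalFormSep : ∀ p : ℕ, p.Prime → ∀ (k : Type) [Field k] [CharP k p] (W : AlgebraicGeometry.Scheme.{0}) [AlgebraicGeometry.IsIntegral W] (f : W ⟶ AlgebraicGeometry.Spec (.of k)) (L : Type) [Field L] [Algebra W.functionField L], AlgebraicGeometry.IsSeparated f → AlgebraicGeometry.LocallyOfFiniteType f → AlgebraicGeometry.QuasiCompact f → Literature.AlgebraicGeometry.Resolution.Scheme.IsRegular W → IsPurelyInseparable W.functionField L → Module.finrank W.functionField L = p → ∃ (W' : AlgebraicGeometry.Scheme.{0}) (_ : AlgebraicGeometry.IsIntegral W') (ρ : W' ⟶ W) (_ : AlgebraicGeometry.IsDominant ρ) (E : List W'.IdealSheafData), AlgebraicGeometry.IsProper ρ ∧ Literature.AlgebraicGeometry.Resolution.IsBirational ρ ∧ Literature.AlgebraicGeometry.Resolution.Scheme.IsRegular W' ∧ Literature.AlgebraicGeometry.Resolution.HasSNC E ∧ ∀ w' : W', ∃ (U : W'.affineOpens) (hU : w' ∈ (U : W'.Opens)) (a : W'.presheaf.obj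 (Opposite.op (U : W'.Opens))), (∃ (y : L) (c : W.functionField), y ∉ (algebraMap W.functionField L).range ∧ y ^ p = algebraMap W.functionField L c ∧ Literature.AlgebraicGeometry.Motives.RatFn.functionFieldMap ρ c = algebraMap (W'.presheaf.stalk w') W'.functionField (W'.presheaf.germ (U : W'.Opens) w' hU a)) ∧ ∀ (w'' : W') (hw'' : w'' ∈ (U : W'.Opens)), ∃ (r : ℕ) (D : Fin r → {D : W'.IdealSheafData // D ∈ E ∧ w'' ∈ D.support}) (x : Fin r → W'.presheaf.stalk w''), Function.Bijective D ∧ (∀ j, Literature.AlgebraicGeometry.Resolution.stalkIdeal (D j).1 w'' = Ideal.span {x j}) ∧ Literature.AlgebraicGeometry.Resolution.GiraudNormalFormAt p x (W'.presheaf.germ (U : W'.Opens) w'' hw'' a) := by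
  sorry

/-- STUB (printed theorem, L-sized literature debt; = 0554 `stub_logResolution`, shared with 0557 and
RadicialJung.CleanResolves).  **Kato 1994 (10.4) / Nizioł 2006 Thm. 5.8**: a scheme carrying a
log-regular Zariski fs atlas has a resolution of singularities (fan subdivision, [KKMS] I Thm. 11).
[cite: Kato1994, (10.4)] -/
theorem stub_kato1994LogRegularGeneral : Literature.AlgebraicGeometry.Resolution.Kato1994_logRegular_hasResolution_general.{0} := by
  sorry

/-- `Picover` (stmt-0554, `PAlteration` copy) from the two stubs — the landed conditional bridge
`GiraudSepReduction.picover_of_giraudNormalFormSep_of_kato` (lead a3's proved charts + Temkin's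
degree-`p` tower p91343). [folklore] -/
theorem picover_of (hG : ∀ p : ℕ, p.Prime → ∀ (k : Type) [Field k] [CharP k p] (W : AlgebraicGeometry.Scheme.{0}) [AlgebraicGeometry.IsIntegral W] (f : W ⟶ AlgebraicGeometry.Spec (.of k)) (L : Type) [Field L] [Algebra W.functionField L], AlgebraicGeometry.IsSeparated f → AlgebraicGeometry.LocallyOfFiniteType f → AlgebraicGeometry.QuasiCompact f → Literature.AlgebraicGeometry.Resolution.Scheme.IsRegular W → IsPurelyInseparable W.functionField L → Module.finrank W.functionField L = p → ∃ (W' : AlgebraicGeometry.Scheme.{0}) (_ : AlgebraicGeometry.IsIntegral W') (ρ : W' ⟶ W) (_ : AlgebraicGeometry.IsDominant ρ) (E : List W'.IdealSheafData), AlgebraicGeometry.IsProper ρ ∧ Literature.AlgebraicGeometry.Resolution.IsBirational ρ ∧ Literature.AlgebraicGeometry.Resolution.Scheme.IsRegular W' ∧ Literature.AlgebraicGeometry.Resolution.HasSNC E ∧ ∀ w' : W', ∃ (U : W'.affineOpens) (hU : w' ∈ (U : W'.Opens)) (a : W'.presheaf.obj (Opposite.op (U : W'.Opens))), (∃ (y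 : L) (c : W.functionField), y ∉ (algebraMap W.functionField L).range ∧ y ^ p = algebraMap W.functionField L c ∧ Literature.AlgebraicGeometry.Motives.RatFn.functionFieldMap ρ c = algebraMap (W'.presheaf.stalk w') W'.functionField (W'.presheaf.germ (U : W'.Opens) w' hU a)) ∧ ∀ (w'' : W') (hw'' : w'' ∈ (U : W'.Opens)), ∃ (r : ℕ) (D : Fin r → {D : W'.IdealSheafData // D ∈ E ∧ w'' ∈ D.support}) (x : Fin r → W'.presheaf.stalk w''), Function.Bijective D ∧ (∀ j, Literature.AlgebraicGeometry.Resolution.stalkIdeal (D j).1 w'' = Ideal.span {x j}) ∧ Literature.AlgebraicGeometry.Resolution.GiraudNormalFormAt p x (W'.presheaf.germ (U : W'.Opens) w'' hw'' a)) (hK : Literature.AlgebraicGeometry.Resolution.Kato1994_logRegular_hasResolution_general.{0}) :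
    Summit.ResolutionOfSingularities.ResolutionOfSingularities.Theses.PAlteration.Picover :=
  Picover.GiraudSepReduction.picover_of_giraudNormalFormSep_of_kato hG hK

/-- **The composition, concluding the crux BY NAME (bet route `EscapeRate`).**
`GNF → Kato (10.4) → EscapeRate.DescentPerfectToAll`, through `Picover` and the landed edge
`descentPerfectToAll_of_picover` (p113743). [folklore] -/
theorem DescentPerfectToAll_of (hG : ∀ p : ℕ, p.Prime → ∀ (k : Type) [Field k] [CharP k p] (W : AlgebraicGeometry.Scheme.{0}) [AlgebraicGeometry.IsIntegral W] (f : W ⟶ AlgebraicGeometry.Spec (.of k)) (L : Type) [Field L] [Algebra W.functionField L], AlgebraicGeometry.IsSeparated f → AlgebraicGeometry.LocallyOfFiniteType f → AlgebraicGeometry.QuasiCompact f → Literature.AlgebraicGeometry.Resolution.Scheme.IsRegular W → IsPurelyInseparable W.functionField L → Module.finrank W.functionField L = p → ∃ (W' : AlgebraicGeometry.Scheme.{0}) (_ : AlgebraicGeometry.IsIntegral W') (ρ : W' ⟶ W) (_ : AlgebraicGeometry.IsDominant ρ) (E : List W'.IdealSheafData), AlgebraicGeometry.IsProper ρ ∧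 Literature.AlgebraicGeometry.Resolution.IsBirational ρ ∧ Literature.AlgebraicGeometry.Resolution.Scheme.IsRegular W' ∧ Literature.AlgebraicGeometry.Resolution.HasSNC E ∧ ∀ w' : W', ∃ (U : W'.affineOpens) (hU : w' ∈ (U : W'.Opens)) (a : W'.presheaf.obj (Opposite.op (U : W'.Opens))), (∃ (y : L) (c : W.functionField), y ∉ (algebraMap W.functionField L).range ∧ y ^ p = algebraMap W.functionField L c ∧ Literature.AlgebraicGeometry.Motives.RatFn.functionFieldMap ρ c = algebraMap (W'.presheaf.stalk w') W'.functionField (W'.presheaf.germ (U : W'.Opens) w' hU a)) ∧ ∀ (w'' : W') (hw'' : w'' ∈ (U : W'.Opens)), ∃ (r : ℕ) (D : Fin r → {D : W'.IdealSheafData // D ∈ E ∧ w'' ∈ D.support}) (x : Fin r → W'.presheaf.stalk w''), Function.Bijective D ∧ (∀ j, Literature.AlgebraicGeometry.Resolution.stalkIdeal (D j).1 w'' = Ideal.span {x j}) ∧ Literature.AlgebraicGeometry.Resolution.GiraudNormalFormAt p x (W'.presheaf.germ (U : W'.Opens) w'' hw'' a)) (hK : Literature.AlgebraicGeometry.Resolution.Kato1994_logRegular_hasResolution_general.{0})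 :
    Summit.ResolutionOfSingularities.ResolutionOfSingularities.Theses.EscapeRate.DescentPerfectToAll :=
  fun p hp H => descentPerfectToAll_of_picover (picover_of hG hK) p hp H

/-- Same composition, concluding the `WeightedInvariant` copy (target of p113743) by name. [folklore] -/
theorem DescentPerfectToAll_of_weightedInvariant (hG : ∀ p : ℕ, p.Prime → ∀ (k : Type) [Field k] [CharP k p] (W : AlgebraicGeometry.Scheme.{0}) [AlgebraicGeometry.IsIntegral W] (f : W ⟶ AlgebraicGeometry.Spec (.of k)) (L : Type) [Field L] [Algebra W.functionField L], AlgebraicGeometry.IsSeparated f → AlgebraicGeometry.LocallyOfFiniteType f → AlgebraicGeometry.QuasiCompact f → Literature.AlgebraicGeometry.Resolution.Scheme.IsRegular W → IsPurelyInseparable W.functionField L → Module.finrank W.functionField L = p → ∃ (W' : AlgebraicGeometry.Scheme.{0}) (_ : AlgebraicGeometry.IsIntegral W') (ρ : W' ⟶ W) (_ : AlgebraicGeometry.IsDominant ρ) (E : List W'.IdealSheafData), AlgebraicGeometry.IsProper ρ ∧ Literature.AlgebraicGeometry.Resolution.IsBirational ρ ∧ Literature.AlgebraicGeometry.Resolution.Scheme.IsRegular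 W' ∧ Literature.AlgebraicGeometry.Resolution.HasSNC E ∧ ∀ w' : W', ∃ (U : W'.affineOpens) (hU : w' ∈ (U : W'.Opens)) (a : W'.presheaf.obj (Opposite.op (U : W'.Opens))), (∃ (y : L) (c : W.functionField), y ∉ (algebraMap W.functionField L).range ∧ y ^ p = algebraMap W.functionField L c ∧ Literature.AlgebraicGeometry.Motives.RatFn.functionFieldMap ρ c = algebraMap (W'.presheaf.stalk w') W'.functionField (W'.presheaf.germ (U : W'.Opens) w' hU a)) ∧ ∀ (w'' : W') (hw'' : w'' ∈ (U : W'.Opens)), ∃ (r : ℕ) (D : Fin r → {D : W'.IdealSheafData // D ∈ E ∧ w'' ∈ D.support}) (x : Fin r → W'.presheaf.stalk w''), Function.Bijective D ∧ (∀ j, Literature.AlgebraicGeometry.Resolution.stalkIdeal (D j).1 w'' = Ideal.span {x j}) ∧ Literature.AlgebraicGeometry.Resolution.GiraudNormalFormAt p x (W'.presheaf.germ (U : W'.Opens) w'' hw'' a)) (hK : Literature.AlgebraicGeometry.Resolution.Kato1994_logRegular_hasResolution_general.{0}) :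
    Summit.ResolutionOfSingularities.ResolutionOfSingularities.Theses.WeightedInvariant.DescentPerfectToAll :=
  descentPerfectToAll_of_picover (picover_of hG hK)

/-- Same composition, concluding the `Descent` copy (the item's original decl) by name. [folklore] -/
theorem DescentPerfectToAll_of_descent (hG : ∀ p : ℕ, p.Prime → ∀ (k : Type) [Field k] [CharP k p] (W : AlgebraicGeometry.Scheme.{0}) [AlgebraicGeometry.IsIntegral W] (f : W ⟶ AlgebraicGeometry.Spec (.of k)) (L : Type) [Field L] [Algebra W.functionField L], AlgebraicGeometry.IsSeparated f → AlgebraicGeometry.LocallyOfFiniteType f → AlgebraicGeometry.QuasiCompact f → Literature.AlgebraicGeometry.Resolution.Scheme.IsRegular W → IsPurelyInseparable W.functionField L → Module.finrank W.functionField L = p → ∃ (W' : AlgebraicGeometry.Scheme.{0}) (_ : AlgebraicGeometry.IsIntegral W') (ρ : W' ⟶ W) (_ : AlgebraicGeometry.IsDominant ρ) (E : List W'.IdealSheafData), AlgebraicGeometry.IsProper ρ ∧ Literature.AlgebraicGeometry.Resolution.IsBirational ρ ∧ Literature.AlgebraicGeometry.Resolution.Scheme.IsRegular W' ∧ Literature.AlgebraicGeometry.Resolution.HasSNC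 E ∧ ∀ w' : W', ∃ (U : W'.affineOpens) (hU : w' ∈ (U : W'.Opens)) (a : W'.presheaf.obj (Opposite.op (U : W'.Opens))), (∃ (y : L) (c : W.functionField), y ∉ (algebraMap W.functionField L).range ∧ y ^ p = algebraMap W.functionField L c ∧ Literature.AlgebraicGeometry.Motives.RatFn.functionFieldMap ρ c = algebraMap (W'.presheaf.stalk w') W'.functionField (W'.presheaf.germ (U : W'.Opens) w' hU a)) ∧ ∀ (w'' : W') (hw'' : w'' ∈ (U : W'.Opens)), ∃ (r : ℕ) (D : Fin r → {D : W'.IdealSheafData // D ∈ E ∧ w'' ∈ D.support}) (x : Fin r → W'.presheaf.stalk w''), Function.Bijective D ∧ (∀ j, Literature.AlgebraicGeometry.Resolution.stalkIdeal (D j).1 w'' = Ideal.span {x j}) ∧ Literature.AlgebraicGeometry.Resolution.GiraudNormalFormAt p x (W'.presheaf.germ (U : W'.Opens) w'' hw'' a)) (hK : Literature.AlgebraicGeometry.Resolution.Kato1994_logRegular_hasResolution_general.{0}) :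
    Summit.ResolutionOfSingularities.ResolutionOfSingularities.Theses.Descent.DescentPerfectToAll :=
  fun p hp H => descentPerfectToAll_of_picover (picover_of hG hK) p hp H

/-- The crux from the (sorried) stubs themselves — bookkeeping form for the stub register. [folklore] -/
theorem DescentPerfectToAll_proof : Summit.ResolutionOfSingularities.ResolutionOfSingularities.Theses.EscapeRate.DescentPerfectToAll :=
  DescentPerfectToAll_of stub_giraudNormalFormSep stub_kato1994LogRegularGeneral

end Summit.ResolutionOfSingularities.ResolutionOfSingularities.Cruxes.DescentPerfectToAll.ViaGiraudSep

end
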